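import Summits.BirchSwinnertonDyer.BirchSwinnertonDyer.Theorems.Rank2ObservatoryRank2Table
import Summits.BirchSwinnertonDyer.BirchSwinnertonDyer.Theorems.Rank2ObservatoryRank2Rows80a
import Summits.BirchSwinnertonDyer.BirchSwinnertonDyer.Theorems.Rank2ObservatoryRank2Rows80b
import Summits.BirchSwinnertonDyer.BirchSwinnertonDyer.Theorems.Rank2ObservatoryRank2Rows81a
import Summits.BirchSwinnertonDyer.BirchSwinnertonDyer.Theorems.Rank2ObservatoryRank2Rows81b
import Summits.BirchSwinnertonDyer.BirchSwinnertonDyer.Theorems.Rank2ObservatoryRank2Rows82a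
import Summits.BirchSwinnertonDyer.BirchSwinnertonDyer.Theorems.Rank2ObservatoryRank2Rows82b
import Summits.BirchSwinnertonDyer.BirchSwinnertonDyer.Theorems.Rank2ObservatoryRank2Rows83a
import Summits.BirchSwinnertonDyer.BirchSwinnertonDyer.Theorems.Rank2ObservatoryRank2Rows83b
import Summits.BirchSwinnertonDyer.BirchSwinnertonDyer.Theorems.Rank2ObservatoryRank2Rows84a
import Summits.BirchSwinnertonDyer.BirchSwinnertonDyer.Theorems.Rank2ObservatoryRank2Rows84b
import Summits.BirchSwinnertonDyer.BirchSwinnertonDyer.Theorems.Rank2ObservatoryRank2Rows85a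
import Summits.BirchSwinnertonDyer.BirchSwinnertonDyer.Theorems.Rank2ObservatoryRank2Rows85b
import Summits.BirchSwinnertonDyer.BirchSwinnertonDyer.Theorems.Rank2ObservatoryRank2Rows86a
import Summits.BirchSwinnertonDyer.BirchSwinnertonDyer.Theorems.Rank2ObservatoryRank2Rows86b
import Summits.BirchSwinnertonDyer.BirchSwinnertonDyer.Theorems.Rank2ObservatoryRank2Rows87a
import Summits.BirchSwinnertonDyer.BirchSwinnertonDyer.Theorems.Rank2ObservatoryRank2Rows87b
import Summits.BirchSwinnertonDyer.BirchSwinnertonDyer.Theorems.Rank2ObservatoryRank2Rows88a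
import Summits.BirchSwinnertonDyer.BirchSwinnertonDyer.Theorems.Rank2ObservatoryRank2Rows88b
import Summits.BirchSwinnertonDyer.BirchSwinnertonDyer.Theorems.Rank2ObservatoryRank2Rows89a
import Summits.BirchSwinnertonDyer.BirchSwinnertonDyer.Theorems.Rank2ObservatoryRank2Rows89b
import HarnessLib

/-!
# BirchSwinnertonDyer — rank ≥ 2 observatory: rank-2 census table, decade 8 of 10 (`400000 ≤ N < 450000`)

HONEST FRAMING: per-curve certified theorems and census instruments; no claim on BSD in rank ≥ 2.

Machine-written AGGREGATION level of the rank-2 census (schema `Rank2ObservatoryRank2Table.lean`, data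
chunks `Rank2ObservatoryRank2Rows80a … 89b`, census `Rank2ObservatoryRank2Census.lean`): `rank2Decade8` is the
concatenation of the 20 chunks of conductor windows 80–89 (`400000 ≤ N < 450000`; a window above the gate's
200 kB file cap is stored as two half-window chunks `NNa`, `NNb`) — rows 274347–311446 of `rank2_table.tsv`
(sha256 `8b151c933b69ee8dae4834c21efd171353ae94c887716c05b7381d12d173f912`), 37100 curves from `400002a1` to
`449995b2`. Its theorems are assembled from the chunk theorems (each a kernel `decide`) by
`List.all_append` / `List.length_append` rewriting only; no row is re-evaluated here. The two-level
assembly (chunks → decades → table) keeps every file under the tree's 400-line limit and every list short.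

Reference: J. E. Cremona, *Algorithms for Modular Elliptic Curves* (2nd ed. 1997), tables / ecdata.
-/

-- single-conjunct summit: `Summit.BirchSwinnertonDyer.BirchSwinnertonDyer.…` repeats the name by design
set_option linter.dupNamespace false

namespace Summit.BirchSwinnertonDyer.BirchSwinnertonDyer.Rank2Observatory

/-- The 20 chunks of decade 8 (conductors `400000 ≤ N < 450000`), in order. [cite: CremonaAlgorithms1997, Tables] -/
noncomputable def rank2Decade8Chunks : List (List Rank2Row) := [
  rank2Rows80a, rank2Rows80b, rank2Rows81a, rank2Rows81b, rank2Rows82a, rank2Rows82b,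
  rank2Rows83a, rank2Rows83b, rank2Rows84a, rank2Rows84b, rank2Rows85a, rank2Rows85b,
  rank2Rows86a, rank2Rows86b, rank2Rows87a, rank2Rows87b, rank2Rows88a, rank2Rows88b,
  rank2Rows89a, rank2Rows89b]

/-- Decade 8 of the rank-2 census table: the 37100 rank-2 curves of conductor `400000 ≤ N < 450000` (rows 274347–311446).
[cite: CremonaAlgorithms1997, Tables] -/
noncomputable def rank2Decade8 : List Rank2Row :=
  rank2Decade8Chunks.flatten

/-- Every row of decade 8 satisfies `Rank2Row.check` (from the 20 chunk theorems). [folklore] -/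
theorem rank2Decade8_check : rank2Decade8.all Rank2Row.check = true := by
  simp only [rank2Decade8, rank2Decade8Chunks, List.flatten_cons, List.flatten_nil, List.all_append, List.all_nil,
    Bool.and_true,
    rank2Rows80a_check, rank2Rows80b_check, rank2Rows81a_check, rank2Rows81b_check,
    rank2Rows82a_check, rank2Rows82b_check, rank2Rows83a_check, rank2Rows83b_check,
    rank2Rows84a_check, rank2Rows84b_check, rank2Rows85a_check, rank2Rows85b_check,
    rank2Rows86a_check, rank2Rows86b_check, rank2Rows87a_check, rank2Rows87b_check,
    rank2Rows88a_check, rank2Rows88b_check, rank2Rows89a_check, rank2Rows89b_check]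

/-- Decade 8 has `37100` rows (sum of the 20 kernel-counted chunk lengths). [cite: CremonaAlgorithms1997, Tables] -/
theorem rank2Decade8_length : rank2Decade8.length = 37100 := by
  simp only [rank2Decade8, rank2Decade8Chunks, List.flatten_cons, List.flatten_nil, List.length_append, List.length_nil,
    rank2Rows80a_length, rank2Rows80b_length, rank2Rows81a_length, rank2Rows81b_length,
    rank2Rows82a_length, rank2Rows82b_length, rank2Rows83a_length, rank2Rows83b_length,
    rank2Rows84a_length, rank2Rows84b_length, rank2Rows85a_length, rank2Rows85b_length,
    rank2Rows86a_length, rank2Rows86b_length, rank2Rows87a_length, rank2Rows87b_length,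
    rank2Rows88a_length, rank2Rows88b_length, rank2Rows89a_length, rank2Rows89b_length]

/-- Every conductor of decade 8 is `< 500 000` (from the 20 kernel-checked chunk ranges).
[cite: CremonaAlgorithms1997, Tables] -/
theorem rank2Decade8_conductor_lt : rank2Decade8.all (fun r => decide (r.N < 500000)) = true := by
  simp only [rank2Decade8, rank2Decade8Chunks, List.flatten_cons, List.flatten_nil, List.all_append, List.all_nil,
    Bool.and_true,
    Rank2Row.all_conductorLt_of_all_range (by norm_num) rank2Rows80a_conductor,
    Rank2Row.all_conductorLt_of_all_range (by norm_num) rank2Rows80b_conductor,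
    Rank2Row.all_conductorLt_of_all_range (by norm_num) rank2Rows81a_conductor,
    Rank2Row.all_conductorLt_of_all_range (by norm_num) rank2Rows81b_conductor,
    Rank2Row.all_conductorLt_of_all_range (by norm_num) rank2Rows82a_conductor,
    Rank2Row.all_conductorLt_of_all_range (by norm_num) rank2Rows82b_conductor,
    Rank2Row.all_conductorLt_of_all_range (by norm_num) rank2Rows83a_conductor,
    Rank2Row.all_conductorLt_of_all_range (by norm_num) rank2Rows83b_conductor,
    Rank2Row.all_conductorLt_of_all_range (by norm_num) rank2Rows84a_conductor,
    Rank2Row.all_conductorLt_of_all_range (by norm_num) rank2Rows84b_conductor,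
    Rank2Row.all_conductorLt_of_all_range (by norm_num) rank2Rows85a_conductor,
    Rank2Row.all_conductorLt_of_all_range (by norm_num) rank2Rows85b_conductor,
    Rank2Row.all_conductorLt_of_all_range (by norm_num) rank2Rows86a_conductor,
    Rank2Row.all_conductorLt_of_all_range (by norm_num) rank2Rows86b_conductor,
    Rank2Row.all_conductorLt_of_all_range (by norm_num) rank2Rows87a_conductor,
    Rank2Row.all_conductorLt_of_all_range (by norm_num) rank2Rows87b_conductor,
    Rank2Row.all_conductorLt_of_all_range (by norm_num) rank2Rows88a_conductor,
    Rank2Row.all_conductorLt_of_all_range (by norm_num) rank2Rows88b_conductor,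
    Rank2Row.all_conductorLt_of_all_range (by norm_num) rank2Rows89a_conductor,
    Rank2Row.all_conductorLt_of_all_range (by norm_num) rank2Rows89b_conductor]

/-- A row of a chunk of decade 8 is a row of the decade. [folklore] -/
theorem mem_rank2Decade8_of_mem_chunk {l : List Rank2Row} (hl : l ∈ rank2Decade8Chunks) {r : Rank2Row} (hr : r ∈ l) :
    r ∈ rank2Decade8 :=
  List.mem_flatten.mpr ⟨l, hl, hr⟩

/-- Chunk 80a is a chunk of decade 8. [folklore] -/
theorem rank2Rows80a_mem_decade8 : rank2Rows80a ∈ rank2Decade8Chunks :=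
  List.mem_iff_getElem?.mpr ⟨0, rfl⟩

/-- Chunk 80b is a chunk of decade 8. [folklore] -/
theorem rank2Rows80b_mem_decade8 : rank2Rows80b ∈ rank2Decade8Chunks :=
  List.mem_iff_getElem?.mpr ⟨1, rfl⟩

/-- Chunk 81a is a chunk of decade 8. [folklore] -/
theorem rank2Rows81a_mem_decade8 : rank2Rows81a ∈ rank2Decade8Chunks :=
  List.mem_iff_getElem?.mpr ⟨2, rfl⟩

/-- Chunk 81b is a chunk of decade 8. [folklore] -/
theorem rank2Rows81b_mem_decade8 : rank2Rows81b ∈ rank2Decade8Chunks :=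
  List.mem_iff_getElem?.mpr ⟨3, rfl⟩

/-- Chunk 82a is a chunk of decade 8. [folklore] -/
theorem rank2Rows82a_mem_decade8 : rank2Rows82a ∈ rank2Decade8Chunks :=
  List.mem_iff_getElem?.mpr ⟨4, rfl⟩

/-- Chunk 82b is a chunk of decade 8. [folklore] -/
theorem rank2Rows82b_mem_decade8 : rank2Rows82b ∈ rank2Decade8Chunks :=
  List.mem_iff_getElem?.mpr ⟨5, rfl⟩

/-- Chunk 83a is a chunk of decade 8. [folklore] -/
theorem rank2Rows83a_mem_decade8 : rank2Rows83a ∈ rank2Decade8Chunks :=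
  List.mem_iff_getElem?.mpr ⟨6, rfl⟩

/-- Chunk 83b is a chunk of decade 8. [folklore] -/
theorem rank2Rows83b_mem_decade8 : rank2Rows83b ∈ rank2Decade8Chunks :=
  List.mem_iff_getElem?.mpr ⟨7, rfl⟩

/-- Chunk 84a is a chunk of decade 8. [folklore] -/
theorem rank2Rows84a_mem_decade8 : rank2Rows84a ∈ rank2Decade8Chunks :=
  List.mem_iff_getElem?.mpr ⟨8, rfl⟩

/-- Chunk 84b is a chunk of decade 8. [folklore] -/
theorem rank2Rows84b_mem_decade8 : rank2Rows84b ∈ rank2Decade8Chunks :=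
  List.mem_iff_getElem?.mpr ⟨9, rfl⟩

/-- Chunk 85a is a chunk of decade 8. [folklore] -/
theorem rank2Rows85a_mem_decade8 : rank2Rows85a ∈ rank2Decade8Chunks :=
  List.mem_iff_getElem?.mpr ⟨10, rfl⟩

/-- Chunk 85b is a chunk of decade 8. [folklore] -/
theorem rank2Rows85b_mem_decade8 : rank2Rows85b ∈ rank2Decade8Chunks :=
  List.mem_iff_getElem?.mpr ⟨11, rfl⟩

/-- Chunk 86a is a chunk of decade 8. [folklore] -/
theorem rank2Rows86a_mem_decade8 : rank2Rows86a ∈ rank2Decade8Chunks :=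
  List.mem_iff_getElem?.mpr ⟨12, rfl⟩

/-- Chunk 86b is a chunk of decade 8. [folklore] -/
theorem rank2Rows86b_mem_decade8 : rank2Rows86b ∈ rank2Decade8Chunks :=
  List.mem_iff_getElem?.mpr ⟨13, rfl⟩

/-- Chunk 87a is a chunk of decade 8. [folklore] -/
theorem rank2Rows87a_mem_decade8 : rank2Rows87a ∈ rank2Decade8Chunks :=
  List.mem_iff_getElem?.mpr ⟨14, rfl⟩

/-- Chunk 87b is a chunk of decade 8. [folklore] -/
theorem rank2Rows87b_mem_decade8 : rank2Rows87b ∈ rank2Decade8Chunks :=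
  List.mem_iff_getElem?.mpr ⟨15, rfl⟩

/-- Chunk 88a is a chunk of decade 8. [folklore] -/
theorem rank2Rows88a_mem_decade8 : rank2Rows88a ∈ rank2Decade8Chunks :=
  List.mem_iff_getElem?.mpr ⟨16, rfl⟩

/-- Chunk 88b is a chunk of decade 8. [folklore] -/
theorem rank2Rows88b_mem_decade8 : rank2Rows88b ∈ rank2Decade8Chunks :=
  List.mem_iff_getElem?.mpr ⟨17, rfl⟩

/-- Chunk 89a is a chunk of decade 8. [folklore] -/
theorem rank2Rows89a_mem_decade8 : rank2Rows89a ∈ rank2Decade8Chunks :=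
  List.mem_iff_getElem?.mpr ⟨18, rfl⟩

/-- Chunk 89b is a chunk of decade 8. [folklore] -/
theorem rank2Rows89b_mem_decade8 : rank2Rows89b ∈ rank2Decade8Chunks :=
  List.mem_iff_getElem?.mpr ⟨19, rfl⟩

end Summit.BirchSwinnertonDyer.BirchSwinnertonDyer.Rank2Observatory
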